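import Literature.AlgebraicGeometry.GroupSchemes.FiniteConnectedSpecialFibre
import HarnessLib

/-!
# Crux `HLiu418` — P6 sub-line **F0-P6b ConnectedEtale**, stub (b1e) `stub_b1e_unitComponentSpecialFibre` PAID

Cell `pub/hodgecm-mathlib`, P6 «MOD programme», HEART input (b1) ∕ DICT (b4′) «canonical line» (LEAD M-1a (3); F0P6c-plan Q1), organ sub-line
`Cruxes/HLiu418/Lines/F0_P6b_ConnectedEtale.lean` ED. 2 (F0P6b-plan (g0); cand v2 sha16 `dca78db9913a38aa`, §6 :243; tree ED. 1 `8210ab19d71568b2`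
commit 8dd49ff07d8f holds ED. 1's five statements and the line-local `IsUnitComponent`), registered-to-be stub `stub_b1e_unitComponentSpecialFibre` (S),
dealt to seat F0P6-p14 (g0) (desk 13:58:07Z).  This file proves THE TEXT of that stub with the line-local predicate
`IsUnitComponent G G₀ j := IsMonHom j ∧ IsOpenImmersion j.left ∧ IsClosedImmersion j.left ∧ ConnectedSpace G₀.left` (§0 of the line) δ-UNFOLDED
token for token (same binders, universe 0; nothing imports a `Cruxes/…/Lines` module), as `stub_b1e_unitComponentSpecialFibre_holds`, so that the desk
folds `stub_b1e_unitComponentSpecialFibre := F0P6bConnectedEtaleStubB1e.stub_b1e_unitComponentSpecialFibre_holds` BY NAME at the next edition (the fold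
elaborates by δ-reduction of `IsUnitComponent`).  The proof is the ★ Literature organ
`Literature.AlgebraicGeometry.GroupSchemes.UnitComponent.natCard_specialFibre_eq_one_of_isClosedImmersion` (`GroupSchemes/FiniteConnectedSpecialFibre.lean`):
`G₀` is finite over `Spec R` (closed immersion into the finite `G`) and CONNECTED, so `Γ(G₀, 𝒪)` — module-finite over the HENSELIAN local ring `R` — is
LOCAL ([StacksProject] Tag 04GG (10), ★ `UnitComponent.isLocalRing_of_connectedSpace`), and a local algebra integral over a local ring has exactly one
prime over the maximal ideal; the group structure, `IsMonHom j` and `IsOpenImmersion j.left` are idle.  HC_CM is proved only modulo the printed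
citations until rung 0 closes; nothing here is about HC — it discharges one registered stub of the P6b ConnectedEtale line.

## References
* [Tate1997FiniteFlatGroupSchemes] J. Tate, *Finite flat group schemes*, in: Modular Forms and Fermat's Last Theorem (1997), (3.7) (I) (the unit
  component over a henselian local base).
* [StacksProject] The Stacks Project, Tag 04GG (finite algebras over henselian local rings are products of local rings).
-/

noncomputable section

set_option autoImplicit false
set_option linter.dupNamespace false

open CategoryTheory CategoryTheory.Limits AlgebraicGeometry MonoidalCategory CartesianMonoidalCategory IsLocalRing
open scoped MonObj

namespace Summit.HodgeConjecture.HodgeConjecture.Cruxes.HLiu418.F0P6bConnectedEtaleStubB1e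

/-- **STUB `stub_b1e_unitComponentSpecialFibre` (line `F0_P6b_ConnectedEtale` ED. 2, §6), its type verbatim with `IsUnitComponent` unfolded** —
over a HENSELIAN local ring `R`, for a finite group scheme `G` (a group object of `Over (Spec R)` with `G → Spec R` finite) and a unit component
`j : G₀ ⟶ G` (homomorphism, open and closed immersion, `G₀` connected), the special fibre of `G₀` has EXACTLY ONE point:
`#{x ∈ G₀ ∣ x ↦ 𝔪_R} = 1` (`Γ(G₀, 𝒪)` is LOCAL, finite over `R`: its primes over `𝔪_R` are its maximal ideal).  Proof: ★
`UnitComponent.natCard_specialFibre_eq_one_of_isClosedImmersion` at universe `0` (only `IsFinite G.hom`, `IsClosedImmersion j.left`,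
`ConnectedSpace G₀.left` are used). [cite: Tate1997FiniteFlatGroupSchemes, (3.7) (I)] [cite: StacksProject, Tag 04GG] -/
theorem stub_b1e_unitComponentSpecialFibre_holds :
    ∀ (R : Type) [CommRing R] [HenselianLocalRing R] (G G₀ : Over (Spec (.of R))) [GrpObj G] [GrpObj G₀] (j : G₀ ⟶ G),
      IsFinite G.hom → (IsMonHom j ∧ IsOpenImmersion j.left ∧ IsClosedImmersion j.left ∧ ConnectedSpace G₀.left) →
        Nat.card {x : G₀.left // G₀.hom.base x = closedPoint R} = 1 := by
  intro R _ _ G G₀ _ _ j hG hj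
  obtain ⟨-, -, h3, h4⟩ := hj
  haveI := hG; haveI := h3; haveI := h4
  exact Literature.AlgebraicGeometry.GroupSchemes.UnitComponent.natCard_specialFibre_eq_one_of_isClosedImmersion R G G₀ j

end Summit.HodgeConjecture.HodgeConjecture.Cruxes.HLiu418.F0P6bConnectedEtaleStubB1e

end
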